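import Summits.BirchSwinnertonDyer.BirchSwinnertonDyer.Theorems.ClassRecordThreeEulerHalvesAtThreeOfUB

/-!
# SECOND LINE «UB∃ᴮ@3» for crux `EulerHalvesAtThree` (item stmt-BirchSwinnertonDyer-19109; routes `ClassRecordThree` r5 = `closes` h₄
# and `KolyvaginRoadThree` h₅) — seat `bsd-stepL-bdp` g19, 2026-08-27; DELIVERED to the planner (HOME/bdp/lines-g19/), NOT registered by
# this seat (the registered decomposition of record is tam3-p1 g7's `Lines/birth.lean` v2: supplyAtThree ∕ factsAtThree ∕
# jetchevDivisibility{Ram,NotRam}HLMulti ∕ twistLower)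

Idea (PROOF-BDP §45 ∕ §47; kernel p524850 ∕ p527805 ∕ p528171 ∕ p528882, all `--supports … --as helper`): the Euler-system half at 3,
ALL THREE CLAUSES of the crux and Tamagawa-INCLUSIVE (the SUM form `ord₃ #Ш(E∕K) + 2·ord₃ ∏c ≤ 2·ord₃[E(K):ℤP]`, which «every
Kolyvagin-system method in print» misses — `…JetchevMax.lean` docstring), from ONE Iwasawa-theoretic input UB∃ᴮ@3 (the
Euler-system inclusion «`(L_𝔭) ⊆ Ch_Λ(X_ac 𝔭bar)·Λ`» of the BDP anticyclotomic main conjecture for `E` itself at `3 ∥ N`, with the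
frame existentially quantified = `Three.BDPExistsAt₃` + the REVERSED `Three.IMCDivAt₃B`) ∘ H2@3 (a THEOREM from the refereed
Liu–Zhang–Zhang fact, thmc-p1 g8 `LZZKernel.bdpValueAt₃_of_thm151_thm153`) ∘ the JSW control identity (PUB fact `thm331_mult`,
`3 ≤ p`) ∘ the ℚ-descent with the twist's `≥`-half from Skinner Thm C (ram twists) ∕ TL₃ (¬ram twists).

Stubs (3 ≤ stubs_max): `stub_ubB₃` (DECIDING; UB∃ᴮ@3 on X11b@3 = hUB of p528882 VERBATIM; SOURCELESS at p = 3 — the cell's memo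
proof of UB, §38–§41, referee-passed, is p ≥ 5; the source programme at 3 is the README's B10 CONSTRUCTION «Λ^ur-integrality +
descent of the LZZ18 object at 3 ∥ N» + an ERL at 3 (π2)) · `stub_twistLowerAtThree` (OPEN, TL₃ — VERBATIM the registered stub of
the birth line; SHARED) · `stub_factsUB₃` (CITABLE by Literature decl name: `JetchevSkinnerWan2017.thm331_anticyclotomicControl_mult`
∧ `LiuZhangZhang2018.thm151_thm153_modularCurve_heegnerVector`, both PUB; thm331_mult is K2 item 19626, LZZ is RULING 18's planned
support `LZZWaldspurgerHeegner`).
Hardest stub: `stub_ubB₃` (as mathematics: a BDP∕Howard∕ERL construction at p = 3 that print does not have).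
Compositions `EulerHalvesAtThree_of (h₆ : ClassRecordThree.PublishedInputsThree) (hub) (htl) (hf)` and the KOLY twin
`EulerHalvesAtThree_of' (h₇ : KolyvaginRoadThree.PublishedInputsKolyThree) …` conclude the two ROUTE DECLS BY NAME (sorry-free).
HONEST FRAMING: sorries ONLY in the three stubs; nothing asserted about any curve; nothing booked (T7); BSD proved for no curve.
Compared with the registered line: TWO open stubs (UB∃ᴮ@3, TL₃) instead of four, no mono∕multi-carrier split, no Kolyvagin-system
rigidity at 3, no 3-adic height, no Shimura curve; but its deciding stub has NO source at 3 whereas the birth line's J₃ inputs are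
IMC-grade readings — the two lines are complementary, not competing.
-/

set_option linter.dupNamespace false
set_option autoImplicit false

noncomputable section

open scoped Classical NumberField

open WeierstrassCurve NumberField IsDedekindDomain Field PowerSeries
open Literature.NumberTheory.EllipticCurves
open Literature.NumberTheory.EllipticCurves.ModularForms
open Literature.NumberTheory.EllipticCurves.Rank1Residual
open Literature.NumberTheory.EllipticCurves.Rank1Residual.Typed
open Literature.NumberTheory.EllipticCurves.JetchevSkinnerWan2017
open Literature.NumberTheory.GaloisRepresentations Literature.NumberTheory.GaloisCohomology
open Literature.NumberTheory.Automorphic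
open Summit.BirchSwinnertonDyer.Rank1Residual Summit.BirchSwinnertonDyer.Rank1Residual.X11b
open Summit.BirchSwinnertonDyer.Rank1Residual.X11b.AcSelmer
open Summit.BirchSwinnertonDyer.Rank1Residual.X11b.Halves
open Summit.BirchSwinnertonDyer.Rank1Residual.X11b.Three

namespace Summit.BirchSwinnertonDyer.BirchSwinnertonDyer.Cruxes.EulerHalvesAtThree.UbB

/-! ## Registered-form stubs (sorries ONLY here) -/

/-- **STUB (DECIDING) · `stub_ubB₃` — UB∃ᴮ@3 on X11b@3:** over x11b3's S0 datum, for every degree-one `𝔭 ∋ 3` and the newform of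
`E`, an embedding datum `ι'` inducing `𝔭` and an `R₀`-frame `(Ω_K ≠ 0, Ω_p ∈ R₀ˣ, L)` with Castella's interpolation property at
`(ι', 𝔭)` such that `(L) ⊆ Ch_Λ(X_ac^∅(E∕K_∞)_{𝔭bar})·R₀⟦T⟧` for every `𝔭bar ∋ 3`, `𝔭bar ≠ 𝔭`. SOURCELESS at p = 3.
[cite: Castella2018, §1 (1.b), Thms. 3.1–3.3 (arXiv:1704.06608 pp. 3, 9) (shapes; nothing asserted at p = 3)]
[cite: Howard2004Compositio, Thm. B (the shape of UB at good p)] -/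
theorem stub_ubB₃ :
    ∀ (W : WeierstrassCurve ℚ) [W.IsElliptic] [W.IsGloballyMinimal], ClassX11b W 3 →
      ∀ (N : ℕ) [NeZero N] (K : Type) [Field K] [NumberField K] (Dt : ModularParametrizationData W N)
      (H : HeegnerDatum N (NumberField.discr K)) (ι : K →+* ℂ) (P : (W.baseChange K).toAffine.Point),
      ClassX11b W 3 → Surj W 3 → W.conductorNorm ℤ = N → IsImaginaryQuadratic K →
      Odd (NumberField.discr K) → SatisfiesHeegnerHypothesis N K →
      (W.quadraticTwist (NumberField.discr K : ℚ)).entireLFunction 1 ≠ 0 →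
      WeierstrassCurve.Affine.Point.map ι.toRatAlgHom P = heegnerPointComplex Dt H →
      ¬ (3 : ℤ) ∣ Dt.c → ¬ IsOfFinAddOrder P →
      ∀ (κ : ZpExtension K 3), κ.IsAnticyclotomic →
        ∀ (γ : Field.absoluteGaloisGroup K) [Fact (κ.IsTopGenerator γ)]
          (𝔭 : HeightOneSpectrum (𝓞 K)), ((3 : ℕ) : 𝓞 K) ∈ 𝔭.asIdeal →
          𝔭.asIdeal.ramificationIdx (𝓞 ℚ) = 1 → 𝔭.asIdeal.inertiaDeg (𝓞 ℚ) = 1 →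
          ∀ (f : CuspForm (CongruenceSubgroup.Gamma0 N) 2), IsNewformOf W f →
            ∃ ι' : PadicAlgCl 3 ≃+* ℂ, InducesPrime ι' 𝔭 ∧
              ∃ (ΩK : ℂ) (Ωp : (unrIntegers 3)ˣ) (L : UnrSeries 3),
                ΩK ≠ 0 ∧ IsBDPLFunction ι' 𝔭 κ γ f ΩK ((Ωp : unrIntegers 3) : ℂ_[3]) L ∧
                ∀ (𝔭bar : HeightOneSpectrum (𝓞 K)), ((3 : ℕ) : 𝓞 K) ∈ 𝔭bar.asIdeal → 𝔭bar ≠ 𝔭 →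
                  Ideal.span {L} ≤
                    (XAc.charIdeal (W.baseChange K) 3 κ 𝔭bar ∅ γ).map (PowerSeries.map (toUnr 3)) := by
  sorry

/-- **STUB (OPEN) · `stub_twistLowerAtThree` — TL₃, VERBATIM the registered stub of the birth line (tam3-p1 g6∕g7): the `≥`-half of
the rank-`0` `3`-part for a multiplicative, irreducible twist (Skinner Thm C's shape without its (ram) hypothesis).**
[cite: Skinner2016PacificMC, Thm. C (shape)] -/
theorem stub_twistLowerAtThree :
    ∀ (V : WeierstrassCurve ℚ) [V.IsElliptic] [V.IsGloballyMinimal],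
      V.HasMultiplicativeReductionAtPrime 3 → V.HasIrreducibleModPGaloisRep 3 →
      V.entireLFunction 1 ≠ 0 → Finite V.sha →
      ∃ q : ℚ, V.entireLFunction 1 / (V.realPeriodRat : ℂ) = (q : ℂ) ∧
        padicValRat 3 q ≤ (padicValNat 3 V.shaOrder : ℤ) + padicValNat 3 V.tamagawaProduct -
          2 * padicValNat 3 V.torsionOrder := by
  sorry

/-- **STUB (CITABLE, by Literature decl name) · `stub_factsUB₃`** — JSW17 Thm. 3.3.1 at a multiplicative `p ≥ 3` (typed, PUB; K2 item
19626) ∧ Liu–Zhang–Zhang 2018 Thms. 1.5.1 ∕ 1.5.3 (typed, PUB; RULING 18's planned support).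
[cite: JetchevSkinnerWan2017, Thm. 3.3.1 with §3.5 (3.5.c)] [cite: LiuZhangZhang2018, Thms. 1.5.1 and 1.5.3] -/
theorem stub_factsUB₃ :
    thm331_anticyclotomicControl_mult ∧ LiuZhangZhang2018.thm151_thm153_modularCurve_heegnerVector := by
  sorry

/-! ## Stub statements by name -/

namespace Statement

/-- Statement of `stub_ubB₃`. -/
abbrev stub_ubB₃ : Prop := type_of% @UbB.stub_ubB₃
/-- Statement of `stub_twistLowerAtThree`. -/
abbrev stub_twistLowerAtThree : Prop := type_of% @UbB.stub_twistLowerAtThree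
/-- Statement of `stub_factsUB₃`. -/
abbrev stub_factsUB₃ : Prop := type_of% @UbB.stub_factsUB₃

end Statement

/-! ## The compositions (sorry-free): the stub STATEMENTS + the route's published-inputs item imply the crux, BY NAME -/

/-- **`EulerHalvesAtThree_of`** (route `ClassRecordThree`) — the crux BY NAME from `PublishedInputsThree` (item 19112, `closes` h₆)
and the three stubs, through bdp g19's `EulerHalfUB.classRecordThree_eulerHalvesAtThree_of_ubB₃_of_items` (p528882). -/
theorem EulerHalvesAtThree_of
    (h₆ : Summit.BirchSwinnertonDyer.BirchSwinnertonDyer.Theses.ClassRecordThree.PublishedInputsThree)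
    (hub : Statement.stub_ubB₃) (htl : Statement.stub_twistLowerAtThree) (hf : Statement.stub_factsUB₃) :
    Summit.BirchSwinnertonDyer.BirchSwinnertonDyer.Theses.ClassRecordThree.EulerHalvesAtThree :=
  Summit.BirchSwinnertonDyer.BirchSwinnertonDyer.Theorems.EulerHalfUB.classRecordThree_eulerHalvesAtThree_of_ubB₃_of_items
    h₆ hf.1 hf.2 hub htl

/-- **`EulerHalvesAtThree_of'`** (route `KolyvaginRoadThree`) — the twin BY NAME from `PublishedInputsKolyThree` (`closes` h₇). -/
theorem EulerHalvesAtThree_of'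
    (h₇ : Summit.BirchSwinnertonDyer.BirchSwinnertonDyer.Theses.KolyvaginRoadThree.PublishedInputsKolyThree)
    (hub : Statement.stub_ubB₃) (htl : Statement.stub_twistLowerAtThree) (hf : Statement.stub_factsUB₃) :
    Summit.BirchSwinnertonDyer.BirchSwinnertonDyer.Theses.KolyvaginRoadThree.EulerHalvesAtThree :=
  Summit.BirchSwinnertonDyer.BirchSwinnertonDyer.Theorems.EulerHalfUB.kolyvaginRoadThree_eulerHalvesAtThree_of_ubB₃_of_items
    h₇ hf.1 hf.2 hub htl

/-- The crux along this line on `ClassRecordThree`, MODULO exactly the three stubs. -/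
theorem EulerHalvesAtThree_proof
    (h₆ : Summit.BirchSwinnertonDyer.BirchSwinnertonDyer.Theses.ClassRecordThree.PublishedInputsThree) :
    Summit.BirchSwinnertonDyer.BirchSwinnertonDyer.Theses.ClassRecordThree.EulerHalvesAtThree :=
  EulerHalvesAtThree_of h₆ stub_ubB₃ stub_twistLowerAtThree stub_factsUB₃

/-- The crux along this line on `KolyvaginRoadThree`, MODULO exactly the three stubs. -/
theorem EulerHalvesAtThree_proof'
    (h₇ : Summit.BirchSwinnertonDyer.BirchSwinnertonDyer.Theses.KolyvaginRoadThree.PublishedInputsKolyThree) :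
    Summit.BirchSwinnertonDyer.BirchSwinnertonDyer.Theses.KolyvaginRoadThree.EulerHalvesAtThree :=
  EulerHalvesAtThree_of' h₇ stub_ubB₃ stub_twistLowerAtThree stub_factsUB₃

end Summit.BirchSwinnertonDyer.BirchSwinnertonDyer.Cruxes.EulerHalvesAtThree.UbB

end
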